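import Mathlib

/-!
# The ratio knapsack `E(n) = U_{p,k} ⊕ B_{⌊√n⌋}(𝔫_d)` — the CHAIN BOUND (B0) for the band: `c·Good ≤ P·Σ_{t≤w} t + r·Bad`
# (Negative lane of crux `DualUnipotentThreeHalves`, supports stmt-ValiantsHypothesis-24318)

val-port-2 g3 (24318 line α `krylov_seed` LEAD; α DEAD ON PAPER — director-valiant R302/R304; hand (ii)(c) of R304: annex §5 (B0) of val-idea-crit-7 g2's
`Cruxes/DualUnipotentThreeHalves/CRITIC-V19-UniformWeightLaw-dead.md` @a92a18731268, first leg val-idea-30 g3 `Ideas/ratio-knapsack.md` §(3)).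
SETTING (a COORDINATE weight certificate `(lvl, r, c)` seen on the band block `Z = {(i, j) : 0 < j − i ≤ w} ⊂ [d]²` of the pencil): levels `L i := lvl(e'_i)`
with `0 ≤ L ≤ P` (`P = p − 1`); the band coordinate `z_{i,i+t}` (present in the pencil) forces the DROP constraint (C) `L (i+t) ≤ L i + r`; it is GOOD (admissible
in `K`) iff it CLIMBS: `L (i+t) + c ≤ L i`.  Along the stride-`t` progression the differences `L i − L (i+t)` telescope, so for each `t`:
`c·#good_t − r·#bad_t ≤ Σ_{i < d−t} (L i − L (i+t)) = Σ_{x<t} (L x − L (d−t+x)) ≤ t·P`, and summing over `t = 1..w`: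

* `sum_sub_shift_le` — the stride telescoping `Σ_{i<N} (L i − L (i+t)) ≤ t·P` for `0 ≤ L ≤ P`;
* `stride_good_le` — for one stride `t`: `c·#good_t ≤ t·P + r·#bad_t`;
* ★ `band_chain_bound` — `c·Σ_{t=1}^{w} #good_t ≤ P·(Σ_{t=1}^{w} t) + r·Σ_{t=1}^{w} #bad_t` (`Σ t = w(w+1)/2`: `sum_Icc_id_eq`), i.e. the annex's
  `(1+ρ)·Bad ≥ D_Z − π·w(w+1)/2` after dividing by `c` (`Good + Bad = D_Z`).
The level function is abstract (`L : ℕ → ℤ`, extended by anything in `[0, P]` beyond `d`); hypotheses inline; no definitions.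

Honest framing: elementary telescoping; nothing here is a `¬`-theorem (the kernel kill of C⁺ needs the torus reduction §3 as hypothesis H and Band Lemma′ §5 (B1));
nothing touches R2 / 24318 / 8062; `VP ≠ VNP` is NOT proved. [val-idea-30 g3 §(3); crit-7 g2 V19 annex §5 (B0)]
-/

-- single-conjunct layout: Sub = Summit, duplicated namespace component intended (the name is mandated)
set_option linter.dupNamespace false
set_option autoImplicit false

open scoped BigOperators

namespace Summit.ValiantsHypothesis.ValiantsHypothesis.Theorems.DualUnipotentThreeHalvesNegative.RatioKnapsackChain

/-- Stride telescoping: `Σ_{i<N} (L i − L (i+t)) = Σ_{x<t} (L x − L (N+x))`. [folklore] -/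
theorem sum_sub_shift_eq (L : ℕ → ℤ) (N t : ℕ) :
    ∑ i ∈ Finset.range N, (L i - L (i + t)) = ∑ x ∈ Finset.range t, (L x - L (N + x)) := by
  have h1 : ∑ x ∈ Finset.range (t + N), L x = ∑ x ∈ Finset.range t, L x + ∑ i ∈ Finset.range N, L (t + i) :=
    Finset.sum_range_add L t N
  have h2 : ∑ x ∈ Finset.range (N + t), L x = ∑ i ∈ Finset.range N, L i + ∑ x ∈ Finset.range t, L (N + x) :=
    Finset.sum_range_add L N t
  have h3 : ∑ i ∈ Finset.range N, L (i + t) = ∑ i ∈ Finset.range N, L (t + i) :=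
    Finset.sum_congr rfl fun i _ => by rw [add_comm]
  rw [Finset.sum_sub_distrib, Finset.sum_sub_distrib, h3, add_comm t N] at *
  linarith

/-- `Σ_{i<N} (L i − L (i+t)) ≤ t·P` for a level function with values in `[0, P]`. [folklore] -/
theorem sum_sub_shift_le (L : ℕ → ℤ) (P : ℤ) (hL0 : ∀ x, 0 ≤ L x) (hLP : ∀ x, L x ≤ P) (N t : ℕ) :
    ∑ i ∈ Finset.range N, (L i - L (i + t)) ≤ (t : ℤ) * P := by
  rw [sum_sub_shift_eq]
  calc ∑ x ∈ Finset.range t, (L x - L (N + x)) ≤ ∑ x ∈ Finset.range t, P :=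
        Finset.sum_le_sum fun x _ => by have := hLP x; have := hL0 (N + x); linarith
    _ = (t : ℤ) * P := by rw [Finset.sum_const, Finset.card_range]; simp

/-- **One stride.**  With the drop constraint `L (i+t) ≤ L i + r` on the `N` pairs `(i, i+t)`, `i < N`, the GOOD pairs (`L (i+t) + c ≤ L i`) satisfy
`c·#good ≤ t·P + r·#bad`. [crit-7 g2 V19 annex §5 (B0), per chain; val-idea-30 g3] -/
theorem stride_good_le (L : ℕ → ℤ) (P r c : ℤ) (hL0 : ∀ x, 0 ≤ L x) (hLP : ∀ x, L x ≤ P) (N t : ℕ)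
    (hC : ∀ i, i < N → L (i + t) ≤ L i + r) :
    c * ((Finset.range N).filter (fun i => L (i + t) + c ≤ L i)).card ≤
      (t : ℤ) * P + r * ((Finset.range N).filter (fun i => ¬ (L (i + t) + c ≤ L i))).card := by
  have htel := sum_sub_shift_le L P hL0 hLP N t
  -- split the telescoping sum into good and bad pairs
  rw [← Finset.sum_filter_add_sum_filter_not (Finset.range N) (fun i => L (i + t) + c ≤ L i)] at htel
  have hgood : c * (((Finset.range N).filter (fun i => L (i + t) + c ≤ L i)).card : ℤ) ≤
      ∑ i ∈ (Finset.range N).filter (fun i => L (i + t) + c ≤ L i), (L i - L (i + t)) := by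
    rw [mul_comm]
    have : ∑ i ∈ (Finset.range N).filter (fun i => L (i + t) + c ≤ L i), c =
        (((Finset.range N).filter (fun i => L (i + t) + c ≤ L i)).card : ℤ) * c := by
      rw [Finset.sum_const]; simp
    rw [← this]
    exact Finset.sum_le_sum fun i hi => by have := (Finset.mem_filter.mp hi).2; linarith
  have hbad : -(r * (((Finset.range N).filter (fun i => ¬ (L (i + t) + c ≤ L i))).card : ℤ)) ≤
      ∑ i ∈ (Finset.range N).filter (fun i => ¬ (L (i + t) + c ≤ L i)), (L i - L (i + t)) := by
    have : ∑ i ∈ (Finset.range N).filter (fun i => ¬ (L (i + t) + c ≤ L i)), (-r) =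
        -(r * (((Finset.range N).filter (fun i => ¬ (L (i + t) + c ≤ L i))).card : ℤ)) := by
      rw [Finset.sum_const]; simp; ring
    rw [← this]
    exact Finset.sum_le_sum fun i hi => by
      have := hC i (Finset.mem_range.mp (Finset.mem_filter.mp hi).1); linarith
  linarith

/-- `Σ_{t=1}^{w} t = w(w+1)/2` in the form `2·Σ = w(w+1)`. [folklore] -/
theorem two_mul_sum_Icc_id (w : ℕ) : 2 * ∑ t ∈ Finset.Icc 1 w, (t : ℤ) = (w : ℤ) * (w + 1) := by
  induction w with
  | zero => simp
  | succ w ih =>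
      rw [Finset.sum_Icc_succ_top (by omega), mul_add, ih]
      push_cast
      ring

/-- ★ **THE CHAIN BOUND (B0).**  For a level function `0 ≤ L ≤ P` on the band of width `w` in `[d]` with the drop constraint on every band pair,
`c·Good ≤ P·Σ_{t=1}^{w} t + r·Bad`, where `Good = Σ_t #{i < d−t : L (i+t) + c ≤ L i}` and `Bad` the rest; since `Good + Bad = D_Z` and `Σ t = w(w+1)/2`
this is the annex's `(c + r)·Bad ≥ c·D_Z − P·w(w+1)/2`. [crit-7 g2 V19 annex §5 (B0); val-idea-30 g3 §(3)] -/
theorem band_chain_bound (d w : ℕ) (L : ℕ → ℤ) (P r c : ℤ) (hL0 : ∀ x, 0 ≤ L x) (hLP : ∀ x, L x ≤ P)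
    (hC : ∀ t i, 1 ≤ t → t ≤ w → i + t < d → L (i + t) ≤ L i + r) :
    c * ∑ t ∈ Finset.Icc 1 w, (((Finset.range (d - t)).filter (fun i => L (i + t) + c ≤ L i)).card : ℤ) ≤
      P * ∑ t ∈ Finset.Icc 1 w, (t : ℤ) +
        r * ∑ t ∈ Finset.Icc 1 w, (((Finset.range (d - t)).filter (fun i => ¬ (L (i + t) + c ≤ L i))).card : ℤ) := by
  rw [Finset.mul_sum, Finset.mul_sum, Finset.mul_sum, ← Finset.sum_add_distrib]
  refine Finset.sum_le_sum fun t ht => ?_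
  have ht' := Finset.mem_Icc.mp ht
  have := stride_good_le L P r c hL0 hLP (d - t) t (fun i hi => hC t i ht'.1 ht'.2 (by omega))
  linarith

end Summit.ValiantsHypothesis.ValiantsHypothesis.Theorems.DualUnipotentThreeHalvesNegative.RatioKnapsackChain
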